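import Summits.KontsevichZagierPeriods.Zeta5Search.SymRayZudilinBridge
import Summits.KontsevichZagierPeriods.Zeta5Search.Certificates.RowCertificate
import HarnessLib

/-!
# ζ(5) search — the Brown–Zudilin totally symmetric row as a `RateCertificate` (calibration NEAR-MISS) (cell `pub-zeta5`, certifier `cert-1`)

HONEST FRAMING: systematic search; no irrationality claim unless certified.

Row 7 of `NEAR-MISSES.md` (Brown–Zudilin 2022 Sect. 2 = Zudilin 2002 in the gauge
`xₙ ↦ (−1)^{n+1} C(2n,n) xₙ`): forms `Qₙ ζ(5) − Pₙ` with `Qₙ` the double binomial sum (7)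
(recursion replayed: `SymmetricRecursion.Q_solvesRec_holds`) and `Pₙ` its companion solution.
ANALYTIC tier, every field a tree theorem (`SymRay.bz_rates_holds : BrownZudilin2022.rates`, i.e.
Zudilin's Theorem 1 on the symmetric ray proved by the cell, + Poincaré):
`b = log λ₃`, `c = −log|λ₂|` with `λ₂ = −0.08438431…`, `λ₃ = 592.0793805…` the roots of
`4x³ − 2368x² − 188x + 1` in the printed brackets.

Outcome: `symmetricRates : RateCertificate (zetaValue 5)` and, for the denominator MODEL `δ = 5`
(`Dₙ ≍ lcm(1..n)⁵` up to bounded factors — Brown–Zudilin (6) as corrected by the cell,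
`SymmetricFamilyCertificates.denominators` exact for `n ≤ 50`, `Zudilin2002.integrality` CITED, not
proved for all `n`; hence a `RateCertificate`, NOT a `RowCertificate`):
**`marginAt 5 = −log|λ₂| − 5 ∈ (−2.5277, −2.5276)`** (exact `−2.52762627…`) and
**`worthinessAt 5 ∈ (0.7779, 0.7780)`** (exact `γ = 0.777959763…`; Brown–Zudilin print `0.77796`;
the record to beat is their Theorem 1's `0.86597135` on the ray `(8,16,10,15,12,16,18,13)`).
Certified decimal brackets: `log λ₃ ∈ (6.3836, 6.3837)`, `log|λ₂| ∈ (−2.4724, −2.4723)`.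
-/

noncomputable section

open Filter Topology Set
open Literature.NumberTheory.Irrationality
open Literature.NumberTheory.Irrationality.BrownZudilin2022 (Q P rates charPoly)
open Literature.NumberTheory.Transcendental (zetaValue)

namespace Summit.KontsevichZagierPeriods.Zeta5Search.Certificates

namespace SymmetricRow

/-! ### Certified logarithm brackets -/

/-- `6.3836 < log 592.0793805` (certified: `e^L = (e^(L/8))^8 ≤ (Taylor₁₄ + err)^8 < 592.0793805000`). -/
theorem log_lam3_lo : (63836 / 10000 : ℝ) < Real.log (5920793805 / 10000000 : ℝ) := by
  have hx : |(15959 / 20000 : ℝ)| ≤ 1 := by rw [abs_le]; constructor <;> norm_num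
  have hb := (abs_sub_le_iff.1 (Real.exp_bound hx (n := 14) (by norm_num))).1
  norm_num [Finset.sum_range_succ, Finset.sum_range_zero, Nat.factorial] at hb
  rw [Real.lt_log_iff_exp_lt (by norm_num), show (63836 / 10000 : ℝ) = ((8:ℕ):ℝ) * (15959 / 20000 : ℝ) by norm_num,
    Real.exp_nat_mul]
  exact lt_of_le_of_lt (pow_le_pow_left₀ (Real.exp_pos _).le hb 8) (by norm_num)

/-- `log 592.0793806 < 6.3837` (certified: `e^U = (e^(U/8))^8 ≥ (Taylor₁₄ − err)^8 > 592.0793806000`). -/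
theorem log_lam3_hi : Real.log (5920793806 / 10000000 : ℝ) < (63837 / 10000 : ℝ) := by
  have hx : |(63837 / 80000 : ℝ)| ≤ 1 := by rw [abs_le]; constructor <;> norm_num
  have hb := (abs_sub_le_iff.1 (Real.exp_bound hx (n := 14) (by norm_num))).2
  norm_num [Finset.sum_range_succ, Finset.sum_range_zero, Nat.factorial] at hb
  have h1 := sub_le_iff_le_add'.mpr hb
  rw [Real.log_lt_iff_lt_exp (by norm_num), show (63837 / 10000 : ℝ) = ((8:ℕ):ℝ) * (63837 / 80000 : ℝ) by norm_num,
    Real.exp_nat_mul]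
  exact lt_of_lt_of_le (by norm_num) (pow_le_pow_left₀ (by norm_num) h1 8)

/-- `-2.4724 < log 0.0843843161` (certified: `e^L = (e^(L/4))^4 ≤ (Taylor₁₄ + err)^4 < 0.0843843161`). -/
theorem log_abs_lam2_lo : (-(24724 / 10000) : ℝ) < Real.log (843843161 / 10000000000 : ℝ) := by
  have hx : |(-(6181 / 10000) : ℝ)| ≤ 1 := by rw [abs_le]; constructor <;> norm_num
  have hb := (abs_sub_le_iff.1 (Real.exp_bound hx (n := 14) (by norm_num))).1
  norm_num [Finset.sum_range_succ, Finset.sum_range_zero, Nat.factorial] at hb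
  rw [Real.lt_log_iff_exp_lt (by norm_num), show (-(24724 / 10000) : ℝ) = ((4:ℕ):ℝ) * (-(6181 / 10000) : ℝ) by norm_num,
    Real.exp_nat_mul]
  exact lt_of_le_of_lt (pow_le_pow_left₀ (Real.exp_pos _).le hb 4) (by norm_num)

/-- `log 0.0843843162 < -2.4723` (certified: `e^U = (e^(U/4))^4 ≥ (Taylor₁₄ − err)^4 > 0.0843843162`). -/
theorem log_abs_lam2_hi : Real.log (843843162 / 10000000000 : ℝ) < (-(24723 / 10000) : ℝ) := by
  have hx : |(-(24723 / 40000) : ℝ)| ≤ 1 := by rw [abs_le]; constructor <;> norm_num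
  have hb := (abs_sub_le_iff.1 (Real.exp_bound hx (n := 14) (by norm_num))).2
  norm_num [Finset.sum_range_succ, Finset.sum_range_zero, Nat.factorial] at hb
  have h1 := sub_le_iff_le_add'.mpr hb
  rw [Real.log_lt_iff_lt_exp (by norm_num), show (-(24723 / 10000) : ℝ) = ((4:ℕ):ℝ) * (-(24723 / 40000) : ℝ) by norm_num,
    Real.exp_nat_mul]
  exact lt_of_lt_of_le (by norm_num) (pow_le_pow_left₀ (by norm_num) h1 4)

/-! ### The two characteristic roots, chosen from the proved fact `BrownZudilin2022.rates` -/

/-- `λ₂ = −0.0843843161…`, the middle root of `4x³ − 2368x² − 188x + 1` (decay base), chosen from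
`SymRay.bz_rates_holds`. -/
def lam₂ : ℝ := SymRay.bz_rates_holds.choose

/-- `λ₃ = 592.0793805…`, the large root (growth base), chosen from `SymRay.bz_rates_holds`. -/
def lam₃ : ℝ := SymRay.bz_rates_holds.choose_spec.choose

/-- The specification of `λ₂, λ₃`: roots in the printed brackets and the three Brown–Zudilin rates. -/
theorem lam_spec :
    charPoly lam₂ = 0 ∧ lam₂ ∈ Ioo (-843843162 / 10 ^ 10 : ℝ) (-843843161 / 10 ^ 10)
    ∧ charPoly lam₃ = 0 ∧ lam₃ ∈ Ioo (5920793805 / 10 ^ 7 : ℝ) (5920793806 / 10 ^ 7)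
    ∧ Tendsto (fun n : ℕ => Real.log |(Q n : ℝ) * zetaValue 5 - (P n : ℝ)| / n) atTop
        (𝓝 (Real.log |lam₂|))
    ∧ Tendsto (fun n : ℕ =>
        Real.log |(Q n : ℝ) * zetaValue 3 - (BrownZudilin2022.Phat n : ℝ)| / n) atTop
        (𝓝 (Real.log |lam₂|))
    ∧ Tendsto (fun n : ℕ => Real.log (Q n : ℝ) / n) atTop (𝓝 (Real.log lam₃)) :=
  SymRay.bz_rates_holds.choose_spec.choose_spec

/-- **`−2.4724 < log|λ₂| < −2.4723`** (`log|λ₂| = −2.47237372…`). -/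
theorem log_abs_lam₂_mem :
    (-(24724 / 10000) : ℝ) < Real.log |lam₂| ∧ Real.log |lam₂| < (-(24723 / 10000) : ℝ) := by
  obtain ⟨-, ⟨h1, h2⟩, -⟩ := lam_spec
  have habs : |lam₂| = -lam₂ := abs_of_neg (by linarith)
  have hlo : (843843161 / 10000000000 : ℝ) < |lam₂| := by rw [habs]; linarith
  have hhi : |lam₂| < (843843162 / 10000000000 : ℝ) := by rw [habs]; linarith
  have hpos : (0 : ℝ) < 843843161 / 10000000000 := by norm_num
  constructor
  · exact log_abs_lam2_lo.trans (Real.log_lt_log hpos hlo)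
  · exact (Real.log_lt_log (hpos.trans hlo) hhi).trans log_abs_lam2_hi

/-- **`6.3836 < log λ₃ < 6.3837`** (`log λ₃ = 6.38364071…`). -/
theorem log_lam₃_mem :
    (63836 / 10000 : ℝ) < Real.log lam₃ ∧ Real.log lam₃ < (63837 / 10000 : ℝ) := by
  obtain ⟨-, -, -, ⟨h1, h2⟩, -⟩ := lam_spec
  have hlo : (5920793805 / 10000000 : ℝ) < lam₃ := by linarith
  have hhi : lam₃ < (5920793806 / 10000000 : ℝ) := by linarith
  have hpos : (0 : ℝ) < 5920793805 / 10000000 := by norm_num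
  constructor
  · exact log_lam3_lo.trans (Real.log_lt_log hpos hlo)
  · exact (Real.log_lt_log (hpos.trans hlo) hhi).trans log_lam3_hi

/-! ### The rate certificate -/

/-- **The totally symmetric row, analytic tier**: `u = Qₙ`, `v = Pₙ`, `b = log λ₃`, `c = −log|λ₂|`. -/
def symmetricRates : RateCertificate (zetaValue 5) where
  u n := (Q n : ℚ)
  v n := P n
  growthRate := Real.log lam₃
  decayRate := -Real.log |lam₂|
  tendsto_growth := by
    refine lam_spec.2.2.2.2.2.2.congr' (Eventually.of_forall fun n => ?_)
    simp only [Rat.cast_natCast, Nat.abs_cast]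
  tendsto_decay := by
    have h := lam_spec.2.2.2.2.1
    simp only [neg_neg, Rat.cast_natCast]
    exact h
  decayRate_pos := by linarith [log_abs_lam₂_mem.2]

/-- The growth rate is `log λ₃`. -/
theorem symmetricRates_growthRate : symmetricRates.growthRate = Real.log lam₃ := rfl

/-- The decay rate is `−log|λ₂|`. -/
theorem symmetricRates_decayRate : symmetricRates.decayRate = -Real.log |lam₂| := rfl

/-- **The margin under the denominator model `δ = 5`**: `μ₁ = −log|λ₂| − 5 ∈ (−2.5277, −2.5276)`
(exact `−2.52762627…` nats/step: the row FAILS C1 by `e^{2.53}` per step). -/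
theorem marginAt_five_mem :
    (-(25277 / 10000) : ℝ) < symmetricRates.marginAt 5 ∧
      symmetricRates.marginAt 5 < (-(25276 / 10000) : ℝ) := by
  rw [RateCertificate.marginAt, symmetricRates_decayRate]
  obtain ⟨h1, h2⟩ := log_abs_lam₂_mem
  constructor <;> linarith

/-- **The worthiness under the denominator model `δ = 5`**: `γ = 1 + μ₁/(log λ₃ + 5) ∈ (0.7779, 0.7780)`
(exact `0.777959763…`; Brown–Zudilin Sect. 2 print `0.77796`). -/
theorem worthinessAt_five_mem :
    (7779 / 10000 : ℝ) < symmetricRates.worthinessAt 5 ∧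
      symmetricRates.worthinessAt 5 < (7780 / 10000 : ℝ) := by
  rw [RateCertificate.worthinessAt, RateCertificate.marginAt, symmetricRates_decayRate,
    symmetricRates_growthRate]
  obtain ⟨h1, h2⟩ := log_abs_lam₂_mem
  obtain ⟨h3, h4⟩ := log_lam₃_mem
  set a := Real.log |lam₂|
  set b := Real.log lam₃
  have hQ : 0 < b + 5 := by linarith
  constructor
  · -- `(−0.2221)(b+5) < −a − 5`
    have : (-(2221 / 10000) : ℝ) * (b + 5) < -a - 5 := by nlinarith
    have := (lt_div_iff₀ hQ).2 this
    linarith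
  · have : -a - 5 < (-(2220 / 10000) : ℝ) * (b + 5) := by nlinarith
    have := (div_lt_iff₀ hQ).2 this
    linarith

/-- The forms `Qₙζ(5) − Pₙ` are eventually non-zero and tend to zero (from the rate alone). -/
theorem symmetric_forms_tendsto_zero : Tendsto symmetricRates.form atTop (𝓝 0) :=
  symmetricRates.tendsto_form

end SymmetricRow

end Summit.KontsevichZagierPeriods.Zeta5Search.Certificates
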